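import Summits.KontsevichZagierPeriods.KontsevichZagierPeriods.Theses.HurwitzMicroSectors
import Literature.NumberTheory.Transcendental.BoxIntegralHurwitz

/-!
# `AperySectorThreeTwo` (route `HurwitzMicroSectors`, stmt-KontsevichZagierPeriods-3873): negative side I —
# witness kit, summit-necessity, non-vacuity

Negative-side support for the crux `AperySectorThreeTwo` (cdisprove unit, refuter
`refuter-cdisprove-stmt-KontsevichZagierPeriods-3873-0`, 2026-08-16; running commentary in the work
file `Cruxes/AperySectorThreeTwo/Disproof.lean`). The crux: two `KZ.IntegralRep 3` on the open box
`(0,1)³` with integrands `P(t)/(1 − t²)`, `P'(t)/(1 − t²)` (`t = x₀x₁x₂`, `P, P' ∈ ℚ[t]`) and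
equal values are `KZ.Equivalent`. Nothing here refutes it; this file records, as importable
theorems:

* §0 the witness kit: `ubox` (the typed open box; `ℚ`-semialgebraic, measurable, Fubini
  `setIntegral_pi_prod`), the members `polyRep Q = [box, Q(t)]` (numerator `Q·(1 − X²)`) with
  `value_polyRep_monomial` (`∫ c·tᵏ = c/(k+1)³`), and `sectorRep P = [box, P(t)/(1 − t²)]` (the
  typed integrand verbatim, absolutely integrable for EVERY `P` by the tree's
  `BoxIntegral.integrableOn_box_prod_pow_div_one_sub_prod_pow`) with the polar values
  `h₀ = 7ζ(3)/8 = 7h₁` (`value_sectorRep_one`, `value_sectorRep_sevenX`, `polar_value_eq`);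
* §1 SUMMIT-NECESSITY `aperySectorThreeTwo_of_summit : KontsevichZagierPeriods → AperySectorThreeTwo`
  (every member `IsRational`): a refutation of the crux would be a disproof of Conjecture 1 for the
  H21 calculus — there is no evaluative refutation channel;
* §2 NON-VACUITY `hypotheses_satisfiable`: the hypotheses on `(r, P)` are met for every `P`.

Companions: `LoadBearing.lean` (the value hypothesis is necessary; refuted strengthenings),
`AdditivityOnly.lean` (rule (1) alone cannot prove the crux).
Sources: M. Kontsevich, D. Zagier, *Periods* (2001), §§1.1–1.2; F. Beukers, Bull. LMS 11 (1979)
(the `ζ(3)` box integral, via the tree's `BoxIntegralHurwitz.lean`).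
-/

noncomputable section

open MeasureTheory Set MvPolynomial intervalIntegral
open Literature.NumberTheory.Transcendental Literature.ModelTheory.ExponentialFields

namespace Summit.KontsevichZagierPeriods.Theorems.AperySectorThreeTwo.Negative

open Summit.KontsevichZagierPeriods.KontsevichZagierPeriods.Theses.HurwitzMicroSectors
  (AperySectorThreeTwo)

/-! ## §0 Witness kit: the open unit box and polynomial-integrand members of the sector -/

/-- The open unit box `(0,1)³`, verbatim as typed in the crux. [folklore] -/
def ubox : Set (Fin 3 → ℝ) := {x | ∀ i, x i ∈ Ioo (0:ℝ) 1}

/-- Auxiliary: `ubox_eq_pi`. [folklore] -/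
theorem ubox_eq_pi : ubox = Set.pi univ fun _ => Ioo (0:ℝ) 1 := by
  ext x; simp [ubox]

/-- Auxiliary: `measurableSet_ubox`. [folklore] -/
theorem measurableSet_ubox : MeasurableSet ubox := by
  rw [ubox_eq_pi]; exact MeasurableSet.univ_pi fun _ => measurableSet_Ioo

/-- Auxiliary: `ubox_subset_Icc`. [folklore] -/
theorem ubox_subset_Icc : ubox ⊆ Icc (0 : Fin 3 → ℝ) 1 :=
  fun _ hx => ⟨fun i => (hx i).1.le, fun i => (hx i).2.le⟩

/-- The open unit box is `ℚ`-semialgebraic. [folklore] -/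
theorem isSemialgebraic_ubox : IsSemialgebraic ℚ ubox := by
  have h : ubox = ⋂ i ∈ (Finset.univ : Finset (Fin 3)),
      ({x : Fin 3 → ℝ | aeval x (C 0 : MvPolynomial (Fin 3) ℚ) < aeval x (X i : MvPolynomial (Fin 3) ℚ)} ∩
       {x : Fin 3 → ℝ | aeval x (X i : MvPolynomial (Fin 3) ℚ) < aeval x (C 1 : MvPolynomial (Fin 3) ℚ)}) := by
    ext x; simp [ubox]
  rw [h]
  exact IsSemialgebraic.biInter _ _ fun i _ =>
    (isSemialgebraic_setOf_eval_lt (k := ℚ) (R := ℝ) _ _).inter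
      (isSemialgebraic_setOf_eval_lt (k := ℚ) (R := ℝ) _ _)

/-- Fubini on a coordinate box for a product integrand. [folklore] -/
theorem setIntegral_pi_prod (s : Fin 3 → Set ℝ) (g : Fin 3 → ℝ → ℝ) :
    ∫ x in Set.pi univ s, ∏ i, g i (x i) = ∏ i, ∫ t in s i, g i t := by
  rw [MeasureTheory.volume_pi, Measure.restrict_pi_pi, integral_fintype_prod_eq_prod]

/-- Auxiliary: `volume_ubox`. [folklore] -/
theorem integral_ubox_one : ∫ _ in ubox, (1 : ℝ) = 1 := by
  have h := setIntegral_pi_prod (fun _ => Ioo (0:ℝ) 1) (fun _ _ => (1 : ℝ))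
  simp only [Finset.prod_const_one] at h
  rw [ubox_eq_pi, h]
  simp

/-- The product coordinate `t = x₀x₁x₂`. [folklore] -/
theorem prod_mem_Ioo {x : Fin 3 → ℝ} (hx : x ∈ ubox) : x 0 * x 1 * x 2 ∈ Ioo (0:ℝ) 1 := by
  have h0 := hx 0; have h1 := hx 1; have h2 := hx 2
  refine ⟨by have := h0.1; have := h1.1; have := h2.1; positivity, ?_⟩
  calc x 0 * x 1 * x 2 < 1 * 1 * 1 := by
        have := mul_lt_mul'' (mul_lt_mul'' h0.2 h1.2 h0.1.le h1.1.le) h2.2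
          (mul_nonneg h0.1.le h1.1.le) h2.1.le
        simpa using this
    _ = 1 := by ring

/-- On the open box the typed denominator `1 − t²` does not vanish. [folklore] -/
theorem one_sub_sq_pos {x : Fin 3 → ℝ} (hx : x ∈ ubox) : 0 < 1 - (x 0 * x 1 * x 2) ^ 2 := by
  have h := prod_mem_Ioo hx
  have : (x 0 * x 1 * x 2) ^ 2 < 1 := by
    have := h.1; have := h.2
    nlinarith
  linarith

/-- The substitution identity `aeval x (P(X₀X₁X₂)) = P(x₀x₁x₂)`. [folklore] -/
theorem aeval_comp_prod (x : Fin 3 → ℝ) (P : Polynomial ℚ) :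
    MvPolynomial.aeval x (Polynomial.aeval (X 0 * X 1 * X 2 : MvPolynomial (Fin 3) ℚ) P) =
      Polynomial.aeval (x 0 * x 1 * x 2) P := by
  rw [← Polynomial.aeval_algHom_apply]
  simp

/-- `[ (0,1)³, Q(x₀x₁x₂) ]`: the member of the sector with numerator `P = Q · (1 − X²)`
(polynomial integrand, bounded, hence absolutely integrable). [folklore] -/
def polyRep (Q : Polynomial ℚ) : KZ.IntegralRep 3 where
  domain := ubox
  integrand x := Polynomial.aeval (x 0 * x 1 * x 2) Q
  isSemialgebraic_domain := isSemialgebraic_ubox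
  isSemialgebraicFunOn_integrand :=
    (isSemialgebraicFunOn_aeval isSemialgebraic_ubox
      (Polynomial.aeval (X 0 * X 1 * X 2 : MvPolynomial (Fin 3) ℚ) Q)).congr
      fun x _ => aeval_comp_prod x Q
  integrableOn := by
    have hc : Continuous fun x : Fin 3 → ℝ => Polynomial.aeval (x 0 * x 1 * x 2) Q :=
      (Polynomial.continuous_aeval Q).comp (by fun_prop)
    exact (hc.continuousOn.integrableOn_compact isCompact_Icc).mono_set ubox_subset_Icc

/-- Auxiliary: `polyRep_domain`. [folklore] -/
@[simp] theorem polyRep_domain (Q : Polynomial ℚ) : (polyRep Q).domain = ubox := rfl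

/-- Auxiliary: `polyRep_integrand`. [folklore] -/
@[simp] theorem polyRep_integrand (Q : Polynomial ℚ) :
    (polyRep Q).integrand = fun x => Polynomial.aeval (x 0 * x 1 * x 2) Q := rfl

/-- `polyRep Q` satisfies the integrand hypothesis of the crux with `P = Q * (1 − X²)`. [folklore] -/
theorem polyRep_eqOn (Q : Polynomial ℚ) :
    EqOn (polyRep Q).integrand
      (fun x => Polynomial.aeval (x 0 * x 1 * x 2) (Q * (1 - Polynomial.X ^ 2)) /
        (1 - (x 0 * x 1 * x 2) ^ 2)) (polyRep Q).domain := by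
  intro x hx
  have h := (one_sub_sq_pos hx).ne'
  simp only [polyRep_integrand, map_mul, map_sub, map_one, map_pow, Polynomial.aeval_X]
  rw [mul_div_assoc, div_self h, mul_one]

/-- Value of a monomial member: `∫_{(0,1)³} c·t^k = c/(k+1)³`. [folklore] -/
theorem value_polyRep_monomial (c : ℚ) (k : ℕ) :
    (polyRep (Polynomial.C c * Polynomial.X ^ k)).value = (c : ℝ) / ((k : ℝ) + 1) ^ 3 := by
  have hint : ∫ t in Ioo (0:ℝ) 1, t ^ k = 1 / ((k : ℝ) + 1) := by
    rw [← integral_Ioc_eq_integral_Ioo, ← intervalIntegral.integral_of_le zero_le_one, integral_pow]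
    simp
  have h := setIntegral_pi_prod (fun _ => Ioo (0:ℝ) 1) (fun _ t => t ^ k)
  simp only [Finset.prod_const, Finset.card_univ, Fintype.card_fin] at h
  show ∫ x in ubox, Polynomial.aeval (x 0 * x 1 * x 2) (Polynomial.C c * Polynomial.X ^ k) = _
  have hfun : (fun x : Fin 3 → ℝ => Polynomial.aeval (x 0 * x 1 * x 2) (Polynomial.C c * Polynomial.X ^ k)) =
      fun x => (c : ℝ) * ∏ i, (x i) ^ k := by
    funext x
    simp [Fin.prod_univ_three, mul_pow]
  rw [hfun, MeasureTheory.integral_const_mul, ubox_eq_pi, h, hint]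
  have hk : ((k : ℝ) + 1) ≠ 0 := by positivity
  field_simp

/-- Value of a constant member: `∫_{(0,1)³} c = c`. [folklore] -/
theorem value_polyRep_C (c : ℚ) : (polyRep (Polynomial.C c)).value = c := by
  have h := value_polyRep_monomial c 0
  simp only [pow_zero, mul_one, Nat.cast_zero, zero_add, one_pow, div_one] at h
  exact h

/-! ## §0b The typed members `sectorRep P`, non-vacuity, and the polar values `h₀ = 7h₁`

`sectorRep P = [ (0,1)³, P(t)/(1 − t²) ]` is the canonical inhabitant of the hypotheses (the typed
integrand verbatim; absolute integrability from the tree's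
`BoxIntegral.integrableOn_box_prod_pow_div_one_sub_prod_pow`), so the `∀ r r' P P'` is non-empty
for every pair of numerators. The polar pair `[box, 1/(1−t²)]`, `[box, 7t/(1−t²)]` has equal
values (`h₀ = 7ζ(3)/8 = 7h₁`, tree: `BoxIntegral.box_integral_level_two_weight_three_zero/one`)
and is again separated by the corner mass, so the distribution relation `H₀ ∼ 7H₁` is NOT an
additivity relation either: the one dilation of the route is unavoidable modulo rule (3). -/

/-- The canonical member `[ (0,1)³, P(x₀x₁x₂)/(1 − (x₀x₁x₂)²) ]` of the sector. [folklore] -/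
def sectorRep (P : Polynomial ℚ) : KZ.IntegralRep 3 where
  domain := ubox
  integrand x := Polynomial.aeval (x 0 * x 1 * x 2) P / (1 - (x 0 * x 1 * x 2) ^ 2)
  isSemialgebraic_domain := isSemialgebraic_ubox
  isSemialgebraicFunOn_integrand := by
    refine (isSemialgebraicFunOn_aeval_div_aeval isSemialgebraic_ubox
      (Polynomial.aeval (X 0 * X 1 * X 2 : MvPolynomial (Fin 3) ℚ) P)
      (1 - (X 0 * X 1 * X 2) ^ 2) ?_).congr ?_
    · intro x hx
      simpa using (one_sub_sq_pos hx).ne'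
    · intro x _
      simp [aeval_comp_prod]
  integrableOn := by
    have h : ∀ i : ℕ, IntegrableOn
        (fun x : Fin 3 → ℝ => (x 0 * x 1 * x 2) ^ i / (1 - (x 0 * x 1 * x 2) ^ 2)) ubox := by
      intro i
      have := BoxIntegral.integrableOn_box_prod_pow_div_one_sub_prod_pow (n := 3) (by norm_num)
        (m := 2) (by norm_num) i
      simp only [Fin.prod_univ_three] at this
      exact this
    have hsum : IntegrableOn (fun x : Fin 3 → ℝ => ∑ i ∈ Finset.range (P.natDegree + 1),
        (P.coeff i : ℝ) * ((x 0 * x 1 * x 2) ^ i / (1 - (x 0 * x 1 * x 2) ^ 2))) ubox :=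
      integrable_finsetSum _ fun i _ => (h i).const_mul _
    refine hsum.congr_fun (fun x _ => ?_) measurableSet_ubox
    rw [Polynomial.aeval_eq_sum_range, Finset.sum_div]
    refine Finset.sum_congr rfl fun i _ => ?_
    rw [Algebra.smul_def, mul_div_assoc]
    simp

/-- Auxiliary: `sectorRep_domain`. [folklore] -/
@[simp] theorem sectorRep_domain (P : Polynomial ℚ) : (sectorRep P).domain = ubox := rfl

/-- Auxiliary: `sectorRep_integrand`. [folklore] -/
@[simp] theorem sectorRep_integrand (P : Polynomial ℚ) :
    (sectorRep P).integrand =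
      fun x => Polynomial.aeval (x 0 * x 1 * x 2) P / (1 - (x 0 * x 1 * x 2) ^ 2) := rfl

/-- **Non-vacuity for every numerator**: the hypotheses of the crux on `(r, P)` are satisfiable
for every `P ∈ ℚ[t]` (the pole at `t = 1` is simple against a triple integral: absolutely
convergent). [folklore] -/
theorem hypotheses_satisfiable (P : Polynomial ℚ) :
    ∃ r : KZ.IntegralRep 3, r.domain = ubox ∧
      EqOn r.integrand (fun x => Polynomial.aeval (x 0 * x 1 * x 2) P / (1 - (x 0 * x 1 * x 2) ^ 2))
        r.domain :=
  ⟨sectorRep P, rfl, fun _ _ => rfl⟩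

/-- `h₀`: the value of `[box, 1/(1−t²)]` is `7ζ(3)/8` (tree: Beukers/Apéry files). [folklore] -/
theorem value_sectorRep_one : (sectorRep (Polynomial.C 1)).value = 7 / 8 * zetaValue 3 := by
  rw [← BoxIntegral.box_integral_level_two_weight_three_zero.2]
  show ∫ x in ubox, (sectorRep (Polynomial.C 1)).integrand x = _
  refine setIntegral_congr_fun measurableSet_ubox fun x _ => ?_
  simp

/-- `7h₁`: the value of `[box, 7t/(1−t²)]` is `7ζ(3)/8` as well. [folklore] -/
theorem value_sectorRep_sevenX :
    (sectorRep (Polynomial.C 7 * Polynomial.X ^ 1)).value = 7 / 8 * zetaValue 3 := by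
  have h := BoxIntegral.box_integral_level_two_weight_three_one.2
  have h7 : ∫ x in ubox, (7 : ℝ) * ((x 0 * x 1 * x 2) ^ 1 / (1 - (x 0 * x 1 * x 2) ^ 2)) =
      7 / 8 * zetaValue 3 := by
    rw [MeasureTheory.integral_const_mul]
    show 7 * ∫ x in {x : Fin 3 → ℝ | ∀ i, x i ∈ Ioo (0:ℝ) 1},
      (x 0 * x 1 * x 2) ^ 1 / (1 - (x 0 * x 1 * x 2) ^ 2) = _
    rw [h]; ring
  rw [← h7]
  show ∫ x in ubox, (sectorRep (Polynomial.C 7 * Polynomial.X ^ 1)).integrand x = _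
  refine setIntegral_congr_fun measurableSet_ubox fun x _ => ?_
  simp [mul_div_assoc]

/-- The polar pair has equal values: `h₀ = 7h₁` (the `m = 2` distribution relation). [folklore] -/
theorem polar_value_eq :
    (sectorRep (Polynomial.C 1)).value = (sectorRep (Polynomial.C 7 * Polynomial.X ^ 1)).value := by
  rw [value_sectorRep_one, value_sectorRep_sevenX]

/-! ## §1 Summit-necessity: the crux is a literal sub-case of the summit -/

/-- Members of the sector have KZ's literal (rational) shape. [folklore] -/
theorem isRational_of_sector {r : KZ.IntegralRep 3} {P : Polynomial ℚ} (hd : r.domain = ubox)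
    (hi : EqOn r.integrand
      (fun x => Polynomial.aeval (x 0 * x 1 * x 2) P / (1 - (x 0 * x 1 * x 2) ^ 2)) r.domain) :
    r.IsRational := by
  refine ⟨Polynomial.aeval (X 0 * X 1 * X 2 : MvPolynomial (Fin 3) ℚ) P,
    1 - (X 0 * X 1 * X 2) ^ 2, ?_, ?_⟩
  · intro x hx
    rw [hd] at hx
    have h := (one_sub_sq_pos hx).ne'
    simpa using h
  · intro x hx
    rw [hi hx]
    simp [aeval_comp_prod]

/-- **Summit-necessity.** `KontsevichZagierPeriods → AperySectorThreeTwo`: the crux is the period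
conjecture restricted to the sector, so `¬ AperySectorThreeTwo → ¬ KontsevichZagierPeriods` — a
refutation of this crux would be a disproof of Conjecture 1 for the H21 calculus. [folklore] -/
theorem aperySectorThreeTwo_of_summit (h : _root_.KontsevichZagierPeriods) : AperySectorThreeTwo := by
  intro r r' P P' hd hd' hi hi' hv
  exact h r r' (isRational_of_sector hd hi) (isRational_of_sector hd' hi') hv

/-- Contrapositive: a refutation of the crux is a disproof of Conjecture 1. [folklore] -/
theorem not_summit_of_not_aperySectorThreeTwo (h : ¬ AperySectorThreeTwo) :
    ¬ _root_.KontsevichZagierPeriods :=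
  mt aperySectorThreeTwo_of_summit h

end Summit.KontsevichZagierPeriods.Theorems.AperySectorThreeTwo.Negative

end
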